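import Summits.AtomisticToContinuum.Crystallization.Theorems.FrustratedLawDichotomyStrainedPatchHomForceCentredLeaf

/-!
# (C′-2) FORCE/EXEMPT PRUNE, centred form — soundness III: the `B`-family per-label lemma `contribB_sound`
# (27623 strained-patch piece, hcp half; decomp-a2c hand-2 g28; sequel of `…HomForceCentredLeaf`)

★★ `contribB_sound` — for EVERY label `b` of the shifted family: if the dispatcher's guard holds there are signed coefficients `κ` (entries) and `σ`
(gradient) inside its `K`/`S` intervals with `cutSlope(v_b)·SC ≤ val + nv + rem/2 + SC·Λ_B κ σ`,
`Λ_B κ σ = Σ_ac Δu_ac κ_ac + Σ_i Δξ_i Σ_a u⁰_ai σ_a + Σ_ai Δu_ai Δξ_i σ_a` (the displacement identity `v − v⁰ = (U − U₀)q + U₀Δξ + (U − U₀)Δξ`,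
`q = P b + t + ξ₀`).  NO definitions; 0 sorry; axioms standard.  `--supports stmt-AtomisticToContinuum-27623`.
-/

namespace Summit.AtomisticToContinuum.Crystallization.Theorems.FrustratedLawDichotomyStrainedPatchHomForceCentredLeafB

open scoped BigOperators RealInnerProductSpace
open Literature.Analysis.ValidatedNumerics.Numerics
open Summit.AtomisticToContinuum.Crystallization.Theorems.ChargedEnergyGapNegative (E3)
open Summit.AtomisticToContinuum.Crystallization.Theorems.FrustratedLawDichotomyStrainedPatchHomSplit (latPt hexFrame hcpShift)
open Summit.AtomisticToContinuum.Crystallization.Theorems.FrustratedLawDichotomyStrainedPatchHomCoords (apply_eq_sum_entries)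
open Summit.AtomisticToContinuum.Crystallization.Theorems.FrustratedLawDichotomyStrainedPatchHomLatticeBox (norm_apply_ge_of_near_one latPt_zero)
open Summit.AtomisticToContinuum.Crystallization.Theorems.FrustratedLawDichotomyStrainedPatchHomLatticeBoxHcp
  (latPt_eq_apply_one norm_sq_hexPt norm_sq_hexPt_add_shift latPt_hex_injective shifted_eq_apply norm_shifted_gt)
open Summit.AtomisticToContinuum.Crystallization.Theorems.FrustratedLawDichotomyStrainedPatchHomEntryGram (entryFI mem_entryFI)
open Summit.AtomisticToContinuum.Crystallization.Theorems.FrustratedLawDichotomyStrainedPatchHomEntryGramHcp (dot3 mem_dot3 shufFI mem_shufFI)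
open Summit.AtomisticToContinuum.Crystallization.Theorems.FrustratedLawDichotomyStrainedPatchHomForceKit
open Summit.AtomisticToContinuum.Crystallization.Theorems.FrustratedLawDichotomyStrainedPatchHomForceSum (cutSlope closedForm_eq_kernel termHi cutSlope_le_termHi)
open Summit.AtomisticToContinuum.Crystallization.Theorems.FrustratedLawDichotomyStrainedPatchHomForceCentred
open Summit.AtomisticToContinuum.Crystallization.Theorems.FrustratedLawDichotomyStrainedPatchHomForceCentredSound
open Summit.AtomisticToContinuum.Crystallization.Theorems.FrustratedLawDichotomyStrainedPatchHomForceCentredLeaf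

/-! ## ★★ The `B`-family per-label lemma -/

/-- ★★ **`B`-FAMILY PER-LABEL SOUNDNESS** (`Λ_B κ σ = Σ_ac Δu_ac κ_ac + Σ_i Δξ_i Σ_a u⁰_ai σ_a + Σ_ai Δu_ai Δξ_i σ_a`). [folklore] -/
theorem contribB_sound {en : Fin 3 → ℤ} {ed : ℕ} (hed : 0 < ed) {sn : ℤ} {sd : ℕ} (hsd : 0 < sd) {τ : ℝ} (h0 : 0 ≤ τ)
    (hs : τ ≤ (sn : ℝ) / sd) {c w : (Fin 3 × Fin 3) ⊕ Fin 3 → ℤ} {U U₀ : E3 →L[ℝ] E3} {ξ ξ₀ : E3} (hU : ‖U - 1‖ ≤ 1 / 4) (hξn : ‖ξ‖ ≤ 1 / 4)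
    (hbox : ∀ ab : Fin 3 × Fin 3, |(U (EuclideanSpace.single ab.2 (1 : ℝ))) ab.1 - (c (Sum.inl ab) : ℝ) / SC| ≤ (w (Sum.inl ab) : ℝ) / SC)
    (hξ : ∀ i : Fin 3, |ξ i - (c (Sum.inr i) : ℝ) / SC| ≤ (w (Sum.inr i) : ℝ) / SC)
    (hU₀ : ∀ ab : Fin 3 × Fin 3, (U₀ (EuclideanSpace.single ab.2 (1 : ℝ))) ab.1 = (c (Sum.inl ab) : ℝ) / SC)
    (hξ₀ : ∀ i : Fin 3, ξ₀ i = (c (Sum.inr i) : ℝ) / SC) (b : Fin 3 → ℤ)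
    (hok : (contribB en ed sn sd c w (boxE c w) (cenE c) (shufFI c w) (cenX c) b).ok = true) :
    ∃ κ : Fin 3 × Fin 3 → ℝ, ∃ σ : Fin 3 → ℝ,
      (∀ ac, FI.mem (κ ac) ((contribB en ed sn sd c w (boxE c w) (cenE c) (shufFI c w) (cenX c) b).K ac)) ∧
      (∀ a, FI.mem (σ a) ((contribB en ed sn sd c w (boxE c w) (cenE c) (shufFI c w) (cenX c) b).S a)) ∧
      cutSlope (latPt U hexFrame b + U (hcpShift + ξ)) (dirVec en ed) τ * SC ≤
        ((contribB en ed sn sd c w (boxE c w) (cenE c) (shufFI c w) (cenX c) b).val : ℝ) +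
          (contribB en ed sn sd c w (boxE c w) (cenE c) (shufFI c w) (cenX c) b).nv +
          ((contribB en ed sn sd c w (boxE c w) (cenE c) (shufFI c w) (cenX c) b).rem : ℝ) / 2 +
          SC * (∑ ac : Fin 3 × Fin 3, ((U (EuclideanSpace.single ac.2 (1 : ℝ))) ac.1 - (c (Sum.inl ac) : ℝ) / SC) * κ ac +
          ∑ i : Fin 3, (ξ i - (c (Sum.inr i) : ℝ) / SC) * ∑ a : Fin 3, ((c (Sum.inl (a, i)) : ℝ) / SC) * σ a +
          ∑ a : Fin 3, ∑ i : Fin 3, ((U (EuclideanSpace.single i (1 : ℝ))) a - (c (Sum.inl (a, i)) : ℝ) / SC) * (ξ i - (c (Sum.inr i) : ℝ) / SC) * σ a) := by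
  have hS := SC_pos
  have hEm : ∀ ab : Fin 3 × Fin 3, FI.mem ((U (EuclideanSpace.single ab.2 (1 : ℝ))) ab.1) (boxE c w ab) := fun ab => mem_entryFI (hbox ab)
  have hXm : ∀ i : Fin 3, FI.mem (ξ i) (shufFI c w i) := fun i => mem_shufFI (hξ i)
  have hE0m : ∀ ab : Fin 3 × Fin 3, FI.mem ((U₀ (EuclideanSpace.single ab.2 (1 : ℝ))) ab.1) (cenE c ab) := mem_cenE hU₀
  have hX0m : ∀ i : Fin 3, FI.mem (ξ₀ i) (cenX c i) := mem_cenX hξ₀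
  have hvV : ∀ a, FI.mem ((latPt U hexFrame b + U (hcpShift + ξ)) a) (vecB (boxE c w) (shufFI c w) b a) := mem_vecB U ξ hEm hXm b
  have hΛ0 : (fun (κ : Fin 3 × Fin 3 → ℝ) (σ : Fin 3 → ℝ) => (∑ ac : Fin 3 × Fin 3, ((U (EuclideanSpace.single ac.2 (1 : ℝ))) ac.1 - (c (Sum.inl ac) : ℝ) / SC) * κ ac + ∑ i : Fin 3, (ξ i - (c (Sum.inr i) : ℝ) / SC) * ∑ a : Fin 3, ((c (Sum.inl (a, i)) : ℝ) / SC) * σ a + ∑ a : Fin 3, ∑ i : Fin 3, ((U (EuclideanSpace.single i (1 : ℝ))) a - (c (Sum.inl (a, i)) : ℝ) / SC) * (ξ i - (c (Sum.inr i) : ℝ) / SC) * σ a)) 0 0 = 0 := by simp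
  have hne : latPt U hexFrame b + U (hcpShift + ξ) ≠ 0 :=
    norm_pos_iff.1 ((by norm_num : (0 : ℝ) < 3 / 8).trans (norm_shifted_gt hU hξn b))
  obtain ⟨o1, h1⟩ : ∃ o, farB b = o := ⟨_, rfl⟩
  cases o1 with
  | true =>
    rw [contribB_far h1]
    exact zero_sound (fun (κ : Fin 3 × Fin 3 → ℝ) (σ : Fin 3 → ℝ) => (∑ ac : Fin 3 × Fin 3, ((U (EuclideanSpace.single ac.2 (1 : ℝ))) ac.1 - (c (Sum.inl ac) : ℝ) / SC) * κ ac + ∑ i : Fin 3, (ξ i - (c (Sum.inr i) : ℝ) / SC) * ∑ a : Fin 3, ((c (Sum.inl (a, i)) : ℝ) / SC) * σ a + ∑ a : Fin 3, ∑ i : Fin 3, ((U (EuclideanSpace.single i (1 : ℝ))) a - (c (Sum.inl (a, i)) : ℝ) / SC) * (ξ i - (c (Sum.inr i) : ℝ) / SC) * σ a)) hΛ0 (cutSlope_eq_zero_of_gt (norm_gt_of_farB hU hξn h1))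
  | false =>
  have hQ : FI.mem (‖latPt U hexFrame b + U (hcpShift + ξ)‖ ^ 2) (dot3 (vecB (boxE c w) (shufFI c w) b) (vecB (boxE c w) (shufFI c w) b)) := by
    rw [← real_inner_self_eq_norm_sq]; exact mem_dot3 hvV hvV
  obtain ⟨o3, h3⟩ : ∃ o, decide (49 * (SC : ℤ) < (dot3 (vecB (boxE c w) (shufFI c w) b) (vecB (boxE c w) (shufFI c w) b)).lo) = o := ⟨_, rfl⟩
  cases o3 with
  | true =>
    rw [contribB_out h1 h3]
    refine zero_sound (fun (κ : Fin 3 × Fin 3 → ℝ) (σ : Fin 3 → ℝ) => (∑ ac : Fin 3 × Fin 3, ((U (EuclideanSpace.single ac.2 (1 : ℝ))) ac.1 - (c (Sum.inl ac) : ℝ) / SC) * κ ac + ∑ i : Fin 3, (ξ i - (c (Sum.inr i) : ℝ) / SC) * ∑ a : Fin 3, ((c (Sum.inl (a, i)) : ℝ) / SC) * σ a + ∑ a : Fin 3, ∑ i : Fin 3, ((U (EuclideanSpace.single i (1 : ℝ))) a - (c (Sum.inl (a, i)) : ℝ) / SC) * (ξ i - (c (Sum.inr i) : ℝ) / SC)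 * σ a)) hΛ0 (cutSlope_eq_zero_of_gt ?_)
    have hlt : 49 * (SC : ℤ) < (dot3 (vecB (boxE c w) (shufFI c w) b) (vecB (boxE c w) (shufFI c w) b)).lo := of_decide_eq_true h3
    have h1' := (FI.mem_def.1 hQ).1
    have hlt' : (49 : ℝ) * SC < ((dot3 (vecB (boxE c w) (shufFI c w) b) (vecB (boxE c w) (shufFI c w) b)).lo : ℝ) := by exact_mod_cast hlt
    have h49 : (49 : ℝ) < ‖latPt U hexFrame b + U (hcpShift + ξ)‖ ^ 2 := by nlinarith
    nlinarith [norm_nonneg (latPt U hexFrame b + U (hcpShift + ξ))]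
  | false =>
  obtain ⟨o4, h4⟩ : ∃ o, decide ((dot3 (vecB (boxE c w) (shufFI c w) b) (vecB (boxE c w) (shufFI c w) b)).hi ≤ near2) = o := ⟨_, rfl⟩
  cases o4 with
  | false =>
    rw [contribB_naive h1 h3 h4] at hok ⊢
    obtain ⟨t, ht⟩ := naive_ok hok
    rw [ht]
    refine naive_sound (fun (κ : Fin 3 × Fin 3 → ℝ) (σ : Fin 3 → ℝ) => (∑ ac : Fin 3 × Fin 3, ((U (EuclideanSpace.single ac.2 (1 : ℝ))) ac.1 - (c (Sum.inl ac) : ℝ) / SC) * κ ac + ∑ i : Fin 3, (ξ i - (c (Sum.inr i) : ℝ) / SC) * ∑ a : Fin 3, ((c (Sum.inl (a, i)) : ℝ) / SC) * σ a + ∑ a : Fin 3, ∑ i : Fin 3, ((U (EuclideanSpace.single i (1 : ℝ))) a - (c (Sum.inl (a, i)) : ℝ) / SC) * (ξ i - (c (Sum.inr i) : ℝ) / SC) * σ a)) hΛ0 ?_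
    exact cutSlope_le_termHi hed hsd h0 hs hvV (skip := false) (fun h => absurd h (by simp)) (fun _ => hne) ht
  | true =>
    rw [contribB_near h1 h3 h4] at hok ⊢
    have h7 : ‖latPt U hexFrame b + U (hcpShift + ξ)‖ ≤ 7 := by
      have hle : (dot3 (vecB (boxE c w) (shufFI c w) b) (vecB (boxE c w) (shufFI c w) b)).hi ≤ near2 := of_decide_eq_true h4
      have h2' := (FI.mem_def.1 hQ).2
      have hle' : ((dot3 (vecB (boxE c w) (shufFI c w) b) (vecB (boxE c w) (shufFI c w) b)).hi : ℝ) ≤ ((near2 : ℤ) : ℝ) := by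
        exact_mod_cast hle
      have hn2 : ((near2 : ℤ) : ℝ) ≤ 25 / 4 * SC := by
        have h' : ((25 * (SC : ℤ) / 4 : ℤ) : ℝ) * 4 ≤ ((25 * (SC : ℤ) : ℤ) : ℝ) := by
          exact_mod_cast Int.ediv_mul_le (25 * (SC : ℤ)) (by norm_num : (4 : ℤ) ≠ 0)
        unfold near2
        push_cast at h' ⊢
        linarith
      have hsq : ‖latPt U hexFrame b + U (hcpShift + ξ)‖ ^ 2 ≤ 7 ^ 2 := by nlinarith
      exact (abs_le_of_sq_le_sq' hsq (by norm_num)).2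
    -- the reference point `q = P b + t + ξ₀` and the centre displacement `v⁰ = U₀ q`
    have hq : ∀ a, FI.mem ((latPt 1 hexFrame b + (1 : E3 →L[ℝ] E3) (hcpShift + ξ₀)) a) (vecB eId (cenX c) b a) := mem_vecB 1 ξ₀ mem_eId hX0m b
    have hv0V : ∀ a, FI.mem ((latPt U₀ hexFrame b + U₀ (hcpShift + ξ₀)) a) (vecB (cenE c) (cenX c) b a) := mem_vecB U₀ ξ₀ hE0m hX0m b
    have hdiff : ∀ a, (latPt U hexFrame b + U (hcpShift + ξ)) a - (latPt U₀ hexFrame b + U₀ (hcpShift + ξ₀)) a =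
        ∑ j : Fin 3, (((U (EuclideanSpace.single j (1 : ℝ))) a - (U₀ (EuclideanSpace.single j (1 : ℝ))) a) *
          (latPt 1 hexFrame b + (1 : E3 →L[ℝ] E3) (hcpShift + ξ₀)) j +
          (U₀ (EuclideanSpace.single j (1 : ℝ))) a * (ξ j - ξ₀ j) +
          ((U (EuclideanSpace.single j (1 : ℝ))) a - (U₀ (EuclideanSpace.single j (1 : ℝ))) a) * (ξ j - ξ₀ j)) := by
      intro a
      rw [shifted_eq_apply, shifted_eq_apply, apply_eq_sum_entries U, apply_eq_sum_entries U₀, ← Finset.sum_sub_distrib]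
      refine Finset.sum_congr rfl fun j _ => ?_
      simp only [PiLp.add_apply, one_apply_eq_self]
      ring
    have hq_abs : ∀ j, |(latPt 1 hexFrame b + (1 : E3 →L[ℝ] E3) (hcpShift + ξ₀)) j| * SC ≤ (FI.absHi (vecB eId (cenX c) b j) : ℝ) :=
      fun j => FI.abs_le_absHi (hq j)
    have hterm1 : ∀ a j : Fin 3, |((U (EuclideanSpace.single j (1 : ℝ))) a - (U₀ (EuclideanSpace.single j (1 : ℝ))) a) *
        (latPt 1 hexFrame b + (1 : E3 →L[ℝ] E3) (hcpShift + ξ₀)) j| * SC ≤ (w (Sum.inl (a, j)) : ℝ) * (FI.absHi (vecB eId (cenX c) b j) : ℝ) / SC := by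
      intro a j
      have hu : |(U (EuclideanSpace.single j (1 : ℝ))) a - (U₀ (EuclideanSpace.single j (1 : ℝ))) a| ≤ (w (Sum.inl (a, j)) : ℝ) / SC := by
        rw [hU₀ (a, j)]; exact hbox (a, j)
      have hw : (0 : ℝ) ≤ (w (Sum.inl (a, j)) : ℝ) / SC := le_trans (abs_nonneg _) hu
      calc |((U (EuclideanSpace.single j (1 : ℝ))) a - (U₀ (EuclideanSpace.single j (1 : ℝ))) a) *
            (latPt 1 hexFrame b + (1 : E3 →L[ℝ] E3) (hcpShift + ξ₀)) j| * SC
          = |(U (EuclideanSpace.single j (1 : ℝ))) a - (U₀ (EuclideanSpace.single j (1 : ℝ))) a| *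
              (|(latPt 1 hexFrame b + (1 : E3 →L[ℝ] E3) (hcpShift + ξ₀)) j| * SC) := by rw [abs_mul]; ring
        _ ≤ (w (Sum.inl (a, j)) : ℝ) / SC * (FI.absHi (vecB eId (cenX c) b j) : ℝ) := mul_le_mul hu (hq_abs j) (by positivity) hw
        _ = (w (Sum.inl (a, j)) : ℝ) * (FI.absHi (vecB eId (cenX c) b j) : ℝ) / SC := by ring
    have hterm2 : ∀ a j : Fin 3, |(U₀ (EuclideanSpace.single j (1 : ℝ))) a * (ξ j - ξ₀ j)| * SC ≤
        (|c (Sum.inl (a, j))| : ℝ) * (w (Sum.inr j) : ℝ) / SC := by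
      intro a j
      have hx : |ξ j - ξ₀ j| ≤ (w (Sum.inr j) : ℝ) / SC := by rw [hξ₀ j]; exact hξ j
      rw [abs_mul, hU₀ (a, j), abs_div, abs_of_pos hS]
      have hw : (0 : ℝ) ≤ (w (Sum.inr j) : ℝ) / SC := le_trans (abs_nonneg _) hx
      calc |(c (Sum.inl (a, j)) : ℝ)| / SC * |ξ j - ξ₀ j| * SC = |(c (Sum.inl (a, j)) : ℝ)| * |ξ j - ξ₀ j| := by field_simp
        _ ≤ |(c (Sum.inl (a, j)) : ℝ)| * ((w (Sum.inr j) : ℝ) / SC) := mul_le_mul_of_nonneg_left hx (abs_nonneg _)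
        _ = (|c (Sum.inl (a, j))| : ℝ) * (w (Sum.inr j) : ℝ) / SC := by ring
    have hterm3 : ∀ a j : Fin 3, |((U (EuclideanSpace.single j (1 : ℝ))) a - (U₀ (EuclideanSpace.single j (1 : ℝ))) a) * (ξ j - ξ₀ j)| * SC ≤
        (w (Sum.inl (a, j)) : ℝ) * (w (Sum.inr j) : ℝ) / SC := by
      intro a j
      have hu : |(U (EuclideanSpace.single j (1 : ℝ))) a - (U₀ (EuclideanSpace.single j (1 : ℝ))) a| ≤ (w (Sum.inl (a, j)) : ℝ) / SC := by
        rw [hU₀ (a, j)]; exact hbox (a, j)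
      have hx : |ξ j - ξ₀ j| ≤ (w (Sum.inr j) : ℝ) / SC := by rw [hξ₀ j]; exact hξ j
      have hw : (0 : ℝ) ≤ (w (Sum.inl (a, j)) : ℝ) / SC := le_trans (abs_nonneg _) hu
      rw [abs_mul]
      calc |(U (EuclideanSpace.single j (1 : ℝ))) a - (U₀ (EuclideanSpace.single j (1 : ℝ))) a| * |ξ j - ξ₀ j| * SC
          ≤ (w (Sum.inl (a, j)) : ℝ) / SC * ((w (Sum.inr j) : ℝ) / SC) * SC := by
            refine mul_le_mul_of_nonneg_right (mul_le_mul hu hx (abs_nonneg _) hw) hS.le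
        _ = (w (Sum.inl (a, j)) : ℝ) * (w (Sum.inr j) : ℝ) / SC := by field_simp
    have hD : ∀ a, |(latPt U hexFrame b + U (hcpShift + ξ)) a - (latPt U₀ hexFrame b + U₀ (hcpShift + ξ₀)) a| * SC ≤
        (dB c w (vecB eId (cenX c) b) a : ℝ) := by
      intro a
      have hc := div_le_cdiv (a := w (Sum.inl (a, 0)) * FI.absHi (vecB eId (cenX c) b 0) + w (Sum.inl (a, 1)) * FI.absHi (vecB eId (cenX c) b 1) +
        w (Sum.inl (a, 2)) * FI.absHi (vecB eId (cenX c) b 2) +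
        (|c (Sum.inl (a, 0))| * w (Sum.inr 0) + |c (Sum.inl (a, 1))| * w (Sum.inr 1) + |c (Sum.inl (a, 2))| * w (Sum.inr 2)) +
        (w (Sum.inl (a, 0)) * w (Sum.inr 0) + w (Sum.inl (a, 1)) * w (Sum.inr 1) + w (Sum.inl (a, 2)) * w (Sum.inr 2))) (b := SC) SCZ_pos
      push_cast at hc
      unfold dB
      push_cast
      refine le_trans ?_ hc
      rw [hdiff a]
      have hj : ∀ j : Fin 3, |((U (EuclideanSpace.single j (1 : ℝ))) a - (U₀ (EuclideanSpace.single j (1 : ℝ))) a) *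
          (latPt 1 hexFrame b + (1 : E3 →L[ℝ] E3) (hcpShift + ξ₀)) j +
          (U₀ (EuclideanSpace.single j (1 : ℝ))) a * (ξ j - ξ₀ j) +
          ((U (EuclideanSpace.single j (1 : ℝ))) a - (U₀ (EuclideanSpace.single j (1 : ℝ))) a) * (ξ j - ξ₀ j)| * SC ≤
          (w (Sum.inl (a, j)) : ℝ) * (FI.absHi (vecB eId (cenX c) b j) : ℝ) / SC + (|c (Sum.inl (a, j))| : ℝ) * (w (Sum.inr j) : ℝ) / SC +
          (w (Sum.inl (a, j)) : ℝ) * (w (Sum.inr j) : ℝ) / SC := by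
        intro j
        have h3 := mul_le_mul_of_nonneg_right (abs_add_three
          (((U (EuclideanSpace.single j (1 : ℝ))) a - (U₀ (EuclideanSpace.single j (1 : ℝ))) a) * (latPt 1 hexFrame b + (1 : E3 →L[ℝ] E3) (hcpShift + ξ₀)) j)
          ((U₀ (EuclideanSpace.single j (1 : ℝ))) a * (ξ j - ξ₀ j))
          (((U (EuclideanSpace.single j (1 : ℝ))) a - (U₀ (EuclideanSpace.single j (1 : ℝ))) a) * (ξ j - ξ₀ j))) hS.le
        linarith [hterm1 a j, hterm2 a j, hterm3 a j]
      calc |∑ j : Fin 3, (((U (EuclideanSpace.single j (1 : ℝ))) a - (U₀ (EuclideanSpace.single j (1 : ℝ))) a) *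
              (latPt 1 hexFrame b + (1 : E3 →L[ℝ] E3) (hcpShift + ξ₀)) j +
              (U₀ (EuclideanSpace.single j (1 : ℝ))) a * (ξ j - ξ₀ j) +
              ((U (EuclideanSpace.single j (1 : ℝ))) a - (U₀ (EuclideanSpace.single j (1 : ℝ))) a) * (ξ j - ξ₀ j))| * SC
          ≤ (∑ j : Fin 3, |((U (EuclideanSpace.single j (1 : ℝ))) a - (U₀ (EuclideanSpace.single j (1 : ℝ))) a) *
              (latPt 1 hexFrame b + (1 : E3 →L[ℝ] E3) (hcpShift + ξ₀)) j +
              (U₀ (EuclideanSpace.single j (1 : ℝ))) a * (ξ j - ξ₀ j) +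
              ((U (EuclideanSpace.single j (1 : ℝ))) a - (U₀ (EuclideanSpace.single j (1 : ℝ))) a) * (ξ j - ξ₀ j)|) * SC :=
            mul_le_mul_of_nonneg_right (Finset.abs_sum_le_sum_abs _ _) hS.le
        _ = ∑ j : Fin 3, |((U (EuclideanSpace.single j (1 : ℝ))) a - (U₀ (EuclideanSpace.single j (1 : ℝ))) a) *
              (latPt 1 hexFrame b + (1 : E3 →L[ℝ] E3) (hcpShift + ξ₀)) j +
              (U₀ (EuclideanSpace.single j (1 : ℝ))) a * (ξ j - ξ₀ j) +
              ((U (EuclideanSpace.single j (1 : ℝ))) a - (U₀ (EuclideanSpace.single j (1 : ℝ))) a) * (ξ j - ξ₀ j)| * SC := Finset.sum_mul _ _ _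
        _ ≤ ∑ j : Fin 3, ((w (Sum.inl (a, j)) : ℝ) * (FI.absHi (vecB eId (cenX c) b j) : ℝ) / SC + (|c (Sum.inl (a, j))| : ℝ) * (w (Sum.inr j) : ℝ) / SC +
              (w (Sum.inl (a, j)) : ℝ) * (w (Sum.inr j) : ℝ) / SC) := Finset.sum_le_sum fun j _ => hj j
        _ = _ := by rw [Fin.sum_univ_three]; ring
    obtain ⟨W, hWK, hWS, hmain⟩ := nearContrib_sound hed hsd h0 hs (v := latPt U hexFrame b + U (hcpShift + ξ))
      (v0 := latPt U₀ hexFrame b + U₀ (hcpShift + ξ₀)) hv0V hq hD hok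
    refine ⟨fun ac => W ac.1 * (latPt 1 hexFrame b + (1 : E3 →L[ℝ] E3) (hcpShift + ξ₀)) ac.2, W, hWK, hWS, ?_⟩
    rw [cutSlope_eq_closedForm hne h7, nearContrib_nv hok]
    have hΛ : (∑ ac : Fin 3 × Fin 3, ((U (EuclideanSpace.single ac.2 (1 : ℝ))) ac.1 - (c (Sum.inl ac) : ℝ) / SC) * (fun ac : Fin 3 × Fin 3 => W ac.1 * (latPt 1 hexFrame b + (1 : E3 →L[ℝ] E3) (hcpShift + ξ₀)) ac.2) ac +
          ∑ i : Fin 3, (ξ i - (c (Sum.inr i) : ℝ) / SC) * ∑ a : Fin 3, ((c (Sum.inl (a, i)) : ℝ) / SC) * W a +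
          ∑ a : Fin 3, ∑ i : Fin 3, ((U (EuclideanSpace.single i (1 : ℝ))) a - (c (Sum.inl (a, i)) : ℝ) / SC) * (ξ i - (c (Sum.inr i) : ℝ) / SC) * W a) =
        ∑ a : Fin 3, W a * ((latPt U hexFrame b + U (hcpShift + ξ)) a - (latPt U₀ hexFrame b + U₀ (hcpShift + ξ₀)) a) := by
      have hU₀' : ∀ a j : Fin 3, (U₀ (EuclideanSpace.single j (1 : ℝ))) a = (c (Sum.inl (a, j)) : ℝ) / SC := fun a j => hU₀ (a, j)
      rw [Fintype.sum_prod_type]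
      simp only [Fin.sum_univ_three]
      rw [hdiff 0, hdiff 1, hdiff 2]
      simp only [Fin.sum_univ_three, hU₀', hξ₀]
      ring
    rw [hΛ]
    push_cast
    linarith [hmain]

end Summit.AtomisticToContinuum.Crystallization.Theorems.FrustratedLawDichotomyStrainedPatchHomForceCentredLeafB
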